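import Summits.CriticalPhenomena.Ising3DConformalLimit.Theses.SubPtolemyInterlacing
import Summits.CriticalPhenomena.Ising3DConformalLimit.Theorems.SubPtolemyInterlacingInterlacingAxisPair
import Summits.CriticalPhenomena.Ising3DConformalLimit.Theorems.SubPtolemyInterlacingInterlacingLogConvex
import Summits.CriticalPhenomena.Ising3DConformalLimit.Theorems.SubPtolemyInterlacingInterlacingMonotone
import Summits.CriticalPhenomena.Ising3DConformalLimit.Theorems.SubPtolemyInterlacingInterlacingLebowitzRegime
import Summits.CriticalPhenomena.Ising3DConformalLimit.Theorems.SubPtolemyInterlacingInterlacingBoxSwitching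
import Summits.CriticalPhenomena.Ising3DConformalLimit.Theorems.SubPtolemyInterlacingInterlacingBoxLimit
import Summits.CriticalPhenomena.Ising3DConformalLimit.Theorems.SubPtolemyInterlacingInterlacingGHSPivot
import Summits.CriticalPhenomena.Ising3DConformalLimit.Theorems.SubPtolemyInterlacingInterlacingGHSRegime
import Summits.CriticalPhenomena.Ising3DConformalLimit.Theorems.SubPtolemyInterlacingInterlacingReduction
import Summits.CriticalPhenomena.Ising3DConformalLimit.Theorems.SubPtolemyInterlacingInterlacingBalancedReduction
import Literature.Probability.LatticeModels.CriticalUrsellFourSign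
import Literature.Probability.LatticeModels.CriticalAxisRatioRegularity
import HarnessLib

/-!
# Line `Sketch` for the crux `SubPtolemyInterlacing.Interlacing`
(item stmt-CriticalPhenomena-15702, route SubPtolemyInterlacing, rank 2 / aside) — lead's working skeleton,
RESHAPED by lead c4 (2026-08-17) with the GHS-pivot branch of the crux idea `ghs-pivot-merging-floor` (k4, r2).
EXTENDED by lead c8 (2026-08-17, ninth lead): stub 11 `stub_balancedReduction` (engine on the balanced family `(2N,N,3N)` →
item stmt-CriticalPhenomena-18014's statement verbatim) registered and LANDED (p162978); open stub unchanged: `stub_engineCore`.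
RESHAPED by lead c7 (2026-08-17, eighth lead): the composition is banked as the registered stub `stub_reduction :
(engine statement) → Interlacing` (provable now, landed as `Theorems/SubPtolemyInterlacingInterlacingReduction.lean`), so
`Interlacing_proof := stub_reduction stub_engineCore` and the only open stub is the engine `stub_engineCore`.

The crux (SPC, "sub-Ptolemy / interlacing"): at `β = β_c(3)`, for all gaps `a, b, c ≥ 1` and the axis
quadruple `x₁ = 0, x₂ = a e₁, x₃ = (a+b) e₁, x₄ = (a+b+c) e₁` of `ℤ³`,
`S₄(x₁,x₂,x₃,x₄) · P₂ ≤ P₁ · P₃` with the three pairings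
`P₁ = G₁₂G₃₄` (adjacent), `P₂ = G₁₃G₂₄` (crossing), `P₃ = G₁₄G₂₃` (nested), `G = ⟨σσ⟩_{β_c}`.

## The line (regime split: Lebowitz corner | GHS regime | hard core, + box merging form)

* **Two-point shadow** (stubs 1–3, LANDED): the dictionary `criticalCorr 3 2 ![m e₁, n e₁] = ⟨σ₀σ_{(n-m)e₁}⟩_{β_c}`,
  axial LOG-CONVEXITY `P₂ ≤ P₃` (`t ≥ 1`) and axial MONOTONICITY `P₂ ≤ P₁` (`u ≥ 1`).
* **Lebowitz corner** (stub 4, LANDED): `S₄ ≤ P₁ + P₂ + P₃` gives SPC whenever `2 P₂² ≤ (P₁ - P₂)(P₃ - P₂)`.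
* **GHS floor** (stub 8 `stub_ghsPivot`, NEW, provable now): GHS in the ensemble pinned at one of the four
  spins (`σ_p = +1`, field at `p` sent to `+∞`) is the four-spin inequality
  `S₄(p,x,y,z) ≤ G_px G_yz + G_py G_xz + G_pz G_xy − 2 G_px G_py G_pz`, i.e. `−U₄ ≥ 2 G_px G_py G_pz`
  (Griffiths–Hurst–Sherman 1970; Aizenman 2025, Part III §11 eq. (GHS)) — for the critical state `criticalCorr 3`
  by the box limit. It is a LOWER bound on `|U₄|` (the first one in this line), lattice-scale (`→ 0` under dilation).
* **GHS regime** (stub 9 `stub_ghsRegime`, NEW, provable now, pure algebra + dictionary): with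
  `π₁ = G(a)G(a+b)G(a+b+c)`, `π₂ = G(a)G(b)G(b+c)`, `π₃ = G(a+b)G(b)G(c)`, `π₄ = G(a+b+c)G(b+c)G(c)` (the four
  pivot tree terms) and `M = max π_j`, the floor gives SPC whenever `(P₁+P₂+P₃)P₂ − P₁P₃ ≤ 2 M P₂`
  (⟺ merging threshold `ι* = 1 − (u−1)(t−1)/2 ≤ max_j R_j`, a TWO-POINT criterion like the Lebowitz corner).
* **Box merging form** (stubs 5–6, LANDED): `S₄^L = P₁^L + P₂^L + P₃^L − 2 P₂^L · 𝐏^{x₁x₃,x₂x₄}_{Λ_L}[x₁ ↔ x₂]`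
  in the free boxes at `β_c`, and the box limit transports an eventual box inequality to the crux at `(a,b,c)`.
* **ENGINE on the HARD CORE** (stub 7′ `stub_engineCore`, the crux's open content): OUTSIDE the Lebowitz corner
  AND outside the GHS regime (`2 M P₂ < (P₁+P₂+P₃)P₂ − P₁P₃`), eventually in `L`,
  `P₂^L (P₁^L + P₂^L + P₃^L) − P₁^L P₃^L ≤ 2 (P₂^L)² · 𝐏^{x₁x₃,x₂x₄}_{Λ_L}[x₁ ↔ x₂]` — the interlaced merging floor
  `𝐏[merge] ≥ ι*` on the explicitly two-point-defined hard core `H = {ι* > max(0, max_j R_j)}`, which contains every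
  balanced shape `(2k,k,3k)`, `k ≥ 2` (there it is a scale-uniform `|U₄| ≥ 0.9·P₂`, ≥ non-Gaussianity of critical
  3D Ising with a constant: OPEN).

`stub_reduction` (stub 10) IS that composition: per `(a,b,c)`, GHS regime → stub 9 fed with stub 8; else the
Lebowitz discriminant: window → the engine hypothesis (fed with stubs 2–3 and the two negated criteria), box identity
(stub 5), box limit (stub 6); corner → stub 4 via the dictionary (stub 1). `Interlacing_proof := stub_reduction stub_engineCore`
concludes the crux BY NAME.
-/

noncomputable section

namespace Summit.CriticalPhenomena.Ising3DConformalLimit.Cruxes.Interlacing.Sketch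

open Filter MeasureTheory
open scoped symmDiff Topology
open Literature.Probability.LatticeModels Literature.Probability.Percolation
open Summit.CriticalPhenomena.Ising3DConformalLimit.Theses.SubPtolemyInterlacing (Interlacing)

/-! ### Stubs 1–6: LANDED (imported)

* `stub_axisPair` — `Theorems/SubPtolemyInterlacingInterlacingAxisPair.lean` (p129148);
* `stub_logConvex` — `…InterlacingLogConvex.lean` (p129236);
* `stub_monotone` — `…InterlacingMonotone.lean` (p129318);
* `stub_lebowitzRegime` — `…InterlacingLebowitzRegime.lean` (p129436);
* `stub_boxSwitching` — `…InterlacingBoxSwitching.lean` (p129565);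
* `stub_boxLimit` — `…InterlacingBoxLimit.lean` (p129649). -/

/-! ### Stubs 8–9: LANDED (imported) — lead c4, wave 1

* `stub_ghsPivot` — `Theorems/SubPtolemyInterlacingInterlacingGHSPivot.lean` (p155773): the GHS-with-a-pivot floor
  `S₄(p,x,y,z) ≤ G_px G_yz + G_py G_xz + G_pz G_xy − 2 G_px G_py G_pz` for `criticalCorr 3` (all sites);
* `stub_ghsRegime` — `Theorems/SubPtolemyInterlacingInterlacingGHSRegime.lean` (p155710): the GHS regime — the two-point
  criterion `(P₁+P₂+P₃)P₂ − P₁P₃ ≤ 2·max_j π_j·P₂` closes the `(a,b,c)` instance (four pivots + dictionary, pure algebra). -/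

/-! ### Stub 7′ — THE ENGINE ON THE HARD CORE (open content of the crux) -/

/-- **Stub 7′ (`stub_engineCore`: box merging threshold on the hard core).** For gaps `a, b, c ≥ 1` OUTSIDE the
Lebowitz corner (`(P₁ − P₂)(P₃ − P₂) < 2 P₂²`, with `P₂ ≤ P₁`, `P₂ ≤ P₃` supplied) AND OUTSIDE the GHS regime
(`2·M·P₂ < (P₁+P₂+P₃)·P₂ − P₁·P₃`, `M` the best pivot tree term as in stub 9), eventually in `L` the interlaced
sourced double currents in `Λ_L` at `β_c` merge often enough:
`P₂^L (P₁^L + P₂^L + P₃^L) − P₁^L P₃^L ≤ 2 (P₂^L)² · 𝐏^{x₁x₃,x₂x₄}_{Λ_L}[x₁ ↔ x₂]` (⟺ `𝐏[merge] ≥ ι*_L`).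
This is the old `stub_engine` restricted to the two-point-defined hard core `H = {ι* > max(0, max_j R_j)}`; `H`
contains every balanced shape `(2k,k,3k)`, `k ≥ 2`, where the statement is a scale-uniform `|U₄| ≥ 0.9·P₂` —
the crux's open content (≥ non-Gaussianity of the critical 3D Ising scaling limit, with a constant). -/
theorem stub_engineCore : ∀ a b c : ℕ, 1 ≤ a → 1 ≤ b → 1 ≤ c →
    criticalTwoPoint 3 (Pi.single 0 ((a + b : ℕ) : ℤ)) * criticalTwoPoint 3 (Pi.single 0 ((b + c : ℕ) : ℤ)) ≤
      criticalTwoPoint 3 (Pi.single 0 ((a : ℕ) : ℤ)) * criticalTwoPoint 3 (Pi.single 0 ((c : ℕ) : ℤ)) →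
    criticalTwoPoint 3 (Pi.single 0 ((a + b : ℕ) : ℤ)) * criticalTwoPoint 3 (Pi.single 0 ((b + c : ℕ) : ℤ)) ≤
      criticalTwoPoint 3 (Pi.single 0 ((a + b + c : ℕ) : ℤ)) * criticalTwoPoint 3 (Pi.single 0 ((b : ℕ) : ℤ)) →
    (criticalTwoPoint 3 (Pi.single 0 ((a : ℕ) : ℤ)) * criticalTwoPoint 3 (Pi.single 0 ((c : ℕ) : ℤ)) -
          criticalTwoPoint 3 (Pi.single 0 ((a + b : ℕ) : ℤ)) * criticalTwoPoint 3 (Pi.single 0 ((b + c : ℕ) : ℤ))) *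
        (criticalTwoPoint 3 (Pi.single 0 ((a + b + c : ℕ) : ℤ)) * criticalTwoPoint 3 (Pi.single 0 ((b : ℕ) : ℤ)) -
          criticalTwoPoint 3 (Pi.single 0 ((a + b : ℕ) : ℤ)) * criticalTwoPoint 3 (Pi.single 0 ((b + c : ℕ) : ℤ))) <
      2 * (criticalTwoPoint 3 (Pi.single 0 ((a + b : ℕ) : ℤ)) * criticalTwoPoint 3 (Pi.single 0 ((b + c : ℕ) : ℤ))) ^ 2 →
    2 * max
          (max (criticalTwoPoint 3 (Pi.single 0 ((a : ℕ) : ℤ)) * criticalTwoPoint 3 (Pi.single 0 ((a + b : ℕ) : ℤ)) *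
              criticalTwoPoint 3 (Pi.single 0 ((a + b + c : ℕ) : ℤ)))
            (criticalTwoPoint 3 (Pi.single 0 ((a : ℕ) : ℤ)) * criticalTwoPoint 3 (Pi.single 0 ((b : ℕ) : ℤ)) *
              criticalTwoPoint 3 (Pi.single 0 ((b + c : ℕ) : ℤ))))
          (max (criticalTwoPoint 3 (Pi.single 0 ((a + b : ℕ) : ℤ)) * criticalTwoPoint 3 (Pi.single 0 ((b : ℕ) : ℤ)) *
              criticalTwoPoint 3 (Pi.single 0 ((c : ℕ) : ℤ)))
            (criticalTwoPoint 3 (Pi.single 0 ((a + b + c : ℕ) : ℤ)) * criticalTwoPoint 3 (Pi.single 0 ((b + c : ℕ) : ℤ)) *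
              criticalTwoPoint 3 (Pi.single 0 ((c : ℕ) : ℤ)))) *
        (criticalTwoPoint 3 (Pi.single 0 ((a + b : ℕ) : ℤ)) * criticalTwoPoint 3 (Pi.single 0 ((b + c : ℕ) : ℤ))) <
      (criticalTwoPoint 3 (Pi.single 0 ((a : ℕ) : ℤ)) * criticalTwoPoint 3 (Pi.single 0 ((c : ℕ) : ℤ)) +
          criticalTwoPoint 3 (Pi.single 0 ((a + b : ℕ) : ℤ)) * criticalTwoPoint 3 (Pi.single 0 ((b + c : ℕ) : ℤ)) +
          criticalTwoPoint 3 (Pi.single 0 ((a + b + c : ℕ) : ℤ)) * criticalTwoPoint 3 (Pi.single 0 ((b : ℕ) : ℤ))) *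
        (criticalTwoPoint 3 (Pi.single 0 ((a + b : ℕ) : ℤ)) * criticalTwoPoint 3 (Pi.single 0 ((b + c : ℕ) : ℤ))) -
      criticalTwoPoint 3 (Pi.single 0 ((a : ℕ) : ℤ)) * criticalTwoPoint 3 (Pi.single 0 ((c : ℕ) : ℤ)) *
        (criticalTwoPoint 3 (Pi.single 0 ((a + b + c : ℕ) : ℤ)) * criticalTwoPoint 3 (Pi.single 0 ((b : ℕ) : ℤ))) →
    ∀ᶠ L : ℕ in atTop,
      isingTwoPoint (zdGraph 3) (box 3 L) (criticalBeta 3) 0 .free (Pi.single 0 ((0 : ℕ) : ℤ)) (Pi.single 0 ((a + b : ℕ) : ℤ)) *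
            isingTwoPoint (zdGraph 3) (box 3 L) (criticalBeta 3) 0 .free (Pi.single 0 ((a : ℕ) : ℤ)) (Pi.single 0 ((a + b + c : ℕ) : ℤ)) *
          (isingTwoPoint (zdGraph 3) (box 3 L) (criticalBeta 3) 0 .free (Pi.single 0 ((0 : ℕ) : ℤ)) (Pi.single 0 ((a : ℕ) : ℤ)) *
            isingTwoPoint (zdGraph 3) (box 3 L) (criticalBeta 3) 0 .free (Pi.single 0 ((a + b : ℕ) : ℤ)) (Pi.single 0 ((a + b + c : ℕ) : ℤ)) +
            isingTwoPoint (zdGraph 3) (box 3 L) (criticalBeta 3) 0 .free (Pi.single 0 ((0 : ℕ) : ℤ)) (Pi.single 0 ((a + b : ℕ) : ℤ)) *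
            isingTwoPoint (zdGraph 3) (box 3 L) (criticalBeta 3) 0 .free (Pi.single 0 ((a : ℕ) : ℤ)) (Pi.single 0 ((a + b + c : ℕ) : ℤ)) +
            isingTwoPoint (zdGraph 3) (box 3 L) (criticalBeta 3) 0 .free (Pi.single 0 ((0 : ℕ) : ℤ)) (Pi.single 0 ((a + b + c : ℕ) : ℤ)) *
            isingTwoPoint (zdGraph 3) (box 3 L) (criticalBeta 3) 0 .free (Pi.single 0 ((a : ℕ) : ℤ)) (Pi.single 0 ((a + b : ℕ) : ℤ))) -
        isingTwoPoint (zdGraph 3) (box 3 L) (criticalBeta 3) 0 .free (Pi.single 0 ((0 : ℕ) : ℤ)) (Pi.single 0 ((a : ℕ) : ℤ)) *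
            isingTwoPoint (zdGraph 3) (box 3 L) (criticalBeta 3) 0 .free (Pi.single 0 ((a + b : ℕ) : ℤ)) (Pi.single 0 ((a + b + c : ℕ) : ℤ)) *
          (isingTwoPoint (zdGraph 3) (box 3 L) (criticalBeta 3) 0 .free (Pi.single 0 ((0 : ℕ) : ℤ)) (Pi.single 0 ((a + b + c : ℕ) : ℤ)) *
            isingTwoPoint (zdGraph 3) (box 3 L) (criticalBeta 3) 0 .free (Pi.single 0 ((a : ℕ) : ℤ)) (Pi.single 0 ((a + b : ℕ) : ℤ))) ≤
      2 * (isingTwoPoint (zdGraph 3) (box 3 L) (criticalBeta 3) 0 .free (Pi.single 0 ((0 : ℕ) : ℤ)) (Pi.single 0 ((a + b : ℕ) : ℤ)) *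
            isingTwoPoint (zdGraph 3) (box 3 L) (criticalBeta 3) 0 .free (Pi.single 0 ((a : ℕ) : ℤ)) (Pi.single 0 ((a + b + c : ℕ) : ℤ))) ^ 2 *
          (sourcedDoubleCurrentLaw 3 L (criticalBeta 3) ({(Pi.single 0 ((0 : ℕ) : ℤ))} ∆ {(Pi.single 0 ((a + b : ℕ) : ℤ))})
            ({(Pi.single 0 ((a : ℕ) : ℤ))} ∆ {(Pi.single 0 ((a + b + c : ℕ) : ℤ))})).real (openConn (Pi.single 0 ((0 : ℕ) : ℤ)) (Pi.single 0 ((a : ℕ) : ℤ))) := by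
  sorry

/-! ### Stub 10 — THE REDUCTION: LANDED (imported) — lead c7

* `stub_reduction` — `Theorems/SubPtolemyInterlacingInterlacingReduction.lean` (p160563): per `(a,b,c)`, the engine at
  `(a,b,c)` (verbatim the instance of `stub_engineCore`) implies the interlacing inequality at `(0,a,a+b,a+b+c)·e₁` in the
  crux's spelling — GHS regime by `stub_ghsRegime` + `stub_ghsPivot`, Lebowitz corner by `stub_lebowitzRegime` + `stub_axisPair`,
  window by the hypothesis + `stub_monotone` / `stub_logConvex` + `stub_boxSwitching` + `stub_boxLimit`. -/

/-! ### Stub 11 — THE BALANCED-FAMILY REDUCTION: LANDED (imported) — lead c8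

* `stub_balancedReduction` — `Theorems/SubPtolemyInterlacingInterlacingBalancedReduction.lean` (p162978): for every `N`,
  the engine at the balanced gaps `(2N, N, 3N)` (verbatim the instance of `stub_engineCore`, gaps summed) implies the
  interlacing inequality at `(0, 2N, 3N, 6N)·e₁` in item stmt-CriticalPhenomena-18014's `Pi.single` spelling; with it
  `eventualBalanced_of_engineBalanced` (conclusion = item 18014's signature VERBATIM) and `ising3D_of_engineBalanced`
  (`+ SubPtolemyFloor + MoebiusLimit → Ising3DConformalLimit`, through `transfer_ising3D_of_balanced`, p140149). Not in the
  cone of `Interlacing_proof`; it records, as a theorem, that `stub_engineCore` restricted to the balanced family is exactly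
  what the route's load-bearing item consumes. -/

/-! ### The composition: the stubs give the crux BY NAME -/

/-- **The crux `Interlacing`** (route `SubPtolemyInterlacing`, stmt-CriticalPhenomena-15702), BY NAME, from the two
stubs of the line `Sketch`: per `(a,b,c)`, the landed reduction (stub 10, p160563) applied to the engine
on the hard core (stub 7′, the crux's open content; on the balanced family it is item stmt-CriticalPhenomena-18014). -/
theorem Interlacing_proof : Interlacing := by
  intro a b c ha hb hc
  exact stub_reduction a b c (stub_engineCore a b c ha hb hc)

end Summit.CriticalPhenomena.Ising3DConformalLimit.Cruxes.Interlacing.Sketch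

end
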